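import Summits.QuantumFields.YangMills.Theorems.BalabanUVNodesN12AtRecord13Prop1KnitThm1WindowDirectOfClassOnlyRowL1NearRadiusOfRecord
import HarnessLib

/-!
# BalabanUVNodes ∕ N12 — THE DIRECT SOCKET's TOLERANCE WINDOW DEMANDS A RADIUS FLOOR `R_i² ≥ 115200·(d−1)·C₁(d,L)·(𝓐₀)²·#bonds(Ω₁(Z_i))·εreg`
# (kernel certificate of the located typing-strength finding «(J0′) × DIRECT: RADIUS COUPLING»; [Balaban1989LargeFieldI] (1.74) p.192, Prop. 1 p.194;
# [Balaban1989LargeFieldII] (1.12)–(1.13) p.359; [Balaban1985Variational] (7) p.278, Thm 1 (8) p.279, Prop. 4 (97)–(98) pp.292–293)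

Cell `pub-ymgap` (HUMAN RULINGS D-0062 ∕ D-0149), seat `pub-ymgap-dag-n12-d` g27 (R134 N12 [B15] s2 = by-name knit at the record; count-neutral helper of K1⁹
`stmt-QuantumFields-27364`, `--kind proof --supports … --as helper`).  THEOREMS ONLY (0 `def`, 0 `instance`, 0 `sorry`); elementary real arithmetic over the DISPLAYED
rows of the direct row socket of record.  NOT a refutation of any tree statement: every theorem of the road stays true; what is certified is which radii its window admits.

WHY.  The plan's E1 ∕ (J0′) column books two objects of record for N12's Proposition-1 row: (i) the DIRECT ROW SOCKET v12 T4 (this seat's g25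
`N12AtRecord13Prop1KnitThm1WindowDirectOfClassOnlyRowL1NearRadiusOfRecord`, #10653 ✓p738673; the same frame in «12X-W-DIRECT v11» ✓p704012), which DISPLAYS the (J0′)
letter `hMin` R-EXPLICITLY (binders `R 𝓐₀ : ∀ P, ι P → ℝ`; per instance an analytic minimiser family on the `R P i`-ball, bound `𝓐₀ P i`, whose REAL points are minimisers
over the class of record `regMSCoPOfRecord F 2 Θ.ν …` = class (6) at threshold `Θ.ν.εreg`) and reads `R P i` in exactly three places: the bookkeeping row `hcJ'`, the output
radius `areg`, and — through the chart's (K) row `p(X_f′X) ≤ (12·𝓐₀∕R)·√#bonds(Ω₁(Z))·‖X‖` (the Federbush velocity of the family bounded by the CAUCHY QUOTIENT sup ∕ radius,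
dag-n12-w4 `…N12DirectChartLetterCore` (K), `…N12NearFlatFederbushVelocityWindow`) — the EXPLICIT THRESHOLD `δ P i ≤ min (…) (εH P i)` whose `S`-term carries
`(12·𝓐₀ P i ∕ R P i·√#bonds)²`; under the threshold sits ONE tolerance row, the window-local producer's k-free FLOOR `hfloor : C₁(d,L)·Θ.ν.εreg + m′·ρn P i ≤ δ P i`
(`C₁(d,L) = (4d+m′+3)²L²∕4 + m′·24((d+2)L)²∕4`, `m′ = 3(d(L−1)∕2)+5`); (ii) the (J0′) HEAD OF RECORD (lane dag-n12-c ✓p740879 `…KnitRowThm1NamedFactsOnZOfRecord`, this seat's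
✓p742351 `…KnitRowOfK0GridGNamedEUOnZOfRecord`, and every predecessor since g25's `…KnitRowThm1Letters` v3), which produces EXACTLY `hMin`'s body — but announces the radius LAST:
`∀ (εr : ℝ), 0 < εr → … → ∀ {ρn}, … → ∃ R : ℝ, 0 < R ∧ ∀ Vk, …` (the radius after the class threshold `εr`, the guard `eR` and the datum tolerance `ρn`).  g25's trigger t132
called the junction a «recipe» («obtain δ₀, then per window obtain R»); the lane's direct-row census (HOME `N12-DIRECT-ROW-CENSUS-2026-08-28.md` §1 F ∕ §3) calls the frame's price
«ONE honest smallness condition on (εreg, eR_i) against the closed-form threshold Θ′_i» — with `R_i` treated as a free per-instance constant.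

WHAT THIS FILE CERTIFIES (kernel).  §1 `radius_sq_floor_of_window_abstract`: for abstract reals in the threshold's exact shape, `0 < δ`-free arithmetic gives
`115200·(d−1)·𝓐₀²·Nb·(C₁·εreg) ≤ R²` (`rhs ≤ 1∕20` from `Kb ≥ 1`; `S ≥ 40(d−1)·Kc²`; `Kc² = 144𝓐₀²Nb∕R²`).  §2 `radius_sq_floor_of_directWindow`: the same at T4's OWN displayed rows
(`hρn`, the threshold row, `hfloor`, written VERBATIM with `x P i ↦ x` at one instance).  §3 `radius_sq_floor_of_directWindow_numeric`: with the family's `d = 4`, `L > 11`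
(`T4Family.P_d ∕ P_L ∕ hL11`: `C₁ ≥ 19²·L²∕4 ≥ 12996`), any non-degenerate instance (`Ω₁(Z P i)` has a bond) and any family bound `𝓐₀ P i ≥ 1` (the family's real points are
`SU(2)`-valued; the head delivers `4𝓐₀′` with `𝓐₀′ > 1`): **`4·10⁹·Θ.ν.εreg ≤ (R P i)²`**.  §3 `false_of_directWindow_of_radius_le`: adding T4's own `hα3` row (⇒ `Θ.ν.εreg ≤ 1`),
a radius `R P i ≤ 10⁴·Θ.ν.εreg` is REFUTED by the window; `false_of_directWindow_of_radius_le_guard`: with T4's `heRa` row and `1 ≤ B₃·(cE+1)`, so is `R P i ≤ 10⁴·eR P i`.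

THE LOCATED FINDING these numbers serve («(J0′) × DIRECT: RADIUS COUPLING», typing-strength → consumability, A2-species, count-neutral; NOT a flag, NOT a gap in print).
(1) STATEMENT LEVEL (hard): the socket needs `Θ.ν.εreg ≤ (R P i)²∕(4·10⁹)` while the head announces `∃ R` only AFTER `εr := Θ.ν.εreg` (and after `eR`, `ρn`): from the two
displayed statements alone NO consumer can exhibit the window `[C₁·εreg + m′ρn, Threshold(R)]` non-empty — the head's `R` is opaque and arrives too late; the pair of record
does not compose into a closable road as typed.  (2) MECHANISM (argument, not kernel): the floor is NOT met by any producer of `hMin`'s displayed shape born from [15] Thm 1 over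
the class of record.  `hMin` demands that every REAL point `(p, B′)` of the `R`-ball yields a MINIMISER OVER class `(6)@εreg` for the perturbed datum; [15] Thm 1 (E)+(8) give that
only while the perturbed datum stays Thm-1-small AND its minimiser stays INSIDE the class — (8): `|∂U′−1| ≤ B₃·ε_datum·η²` with `B₃·ε_datum ≤ εreg` (T4's own `heRa` and the
head's `B₃·((cE+1)·2eR) ≤ εr` are this margin at `ε := (cE+1)·eR`, resp. `2(cE+1)·eR`) — so the admissible perturbation, hence `R`, is of the order of the class margin
`εreg∕B₃` (the head's proof: `B15Prop1MinimiserFamilyAtRecord.hMin_of_baseFieldLetters`, clause `hclass : ∀ᶠ Q in 𝓝 (coeField U₀), … U′ ∈ reg` — the class read as a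
NEIGHBOURHOOD of the base minimiser — and `hT1u` at the lane's per-base-field rows with `ε := 2eR`; compactness then takes a minimum).  A radius `O(εreg)` (or `O(eR)`) against a floor
`6·10⁴·√εreg`: empty for every `εreg < 1` (§3).  Print is not touched by this: [IV] Prop. 1 p.194 ([LF-II] pp.358–359 via [B5] (1.65)–(1.67) + [15] Prop. 4) never divides by the
analyticity radius — the derivative of the minimiser in the datum is bounded by [15] Prop. 4's Lipschitz constants «depending on d and L only» ((97)–(98) pp.292–293).

REPAIR CENSUS (for the plan ∕ the lane; this seat types none of them today).  WHERE clause 3 of `hMin` (minimality at perturbed real points) is CONSUMED: the chart half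
`hhalf` only EVENTUALLY (`∀ᶠ Y in 𝓝 0, IsMinimizer … (expChart U₀ (Xf Y))`), the endpoint's real-point clause only on the OUTPUT ball `areg ≤ R∕8`; the (K) row needs only the
family's DERIVATIVE at `0` (Cauchy: analyticity + bound on the ball, no minimality there).  So the radius in the THRESHOLD (analyticity) and the radius of MINIMALITY need not coincide —
T4 uses one `R` for both, and the class-margin cap of (2) bites only the second.  (r1) re-order the head as is (`∃ R` before `εr`): DEAD as a knit (its single radius is born from
margins that shrink with the class).  (r2′) ★ «CAP CLASS + TWO RADII» (no new unproved input): `hMin² := ∃ R_an 𝓐₀` (announced BEFORE `εr`) `… ∃ R_min ≤ R_an` (after `εr`): pose the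
base problem in the cap class (`U₀` := minimiser over class(cap); (8) ⇒ `U₀ ∈ class(B₃·ε_datum) ⊆ class(εr)` ⇒ `U₀` minimises over class(εr) by the definitional monotonicity of
`B15DeterminingSets.IsMinimizer` in the class), take `R_an`, `𝓐₀` from the class-free IFT family + compactness, and `R_min(εr) = min (R_min(cap), (εr∕B₃ − ε_datum)∕c)`; T side: the
threshold reads `R_an`, `areg` reads `R_min`, the window `C₁εreg + m′ρn ≤ δ ≤ Thr(R_an)` becomes CHECKABLE.  Size L (bottom lemma `hMin_of_baseFieldLetters` split; heads re-threaded;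
(P2c) → T4 two-radii editions).  (r4) ★ PRINT's LITERAL ROAD: re-key the (K) row on a LIPSCHITZ velocity letter ([15] Prop. 4 (97)–(98); tree: `B11.Prop4Printed`,
`B11Prop4Assembly.prop4Hyp`, dag-n12-c g3 `B15Prop1LipschitzFromProp4`) instead of the Cauchy quotient `12𝓐₀∕R` — `R` then leaves the threshold (stays in `hcJ'`∕`areg`), at the
price of ONE new named [15] input (unproved today; it also serves census U2 later); M–L.  Plan's call between (r2′) and (r4); this seat OFFERS the Summits-side editions of either.

HONEST FRAMING.  Five arithmetic theorems over displayed rows; no statement of the tree is refuted (T4, the heads, the endpoint chain all stand as typed and PASSed); what is shown is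
that their COMPOSITION is empty at every `εreg < 1` for radii `R ≤ 10⁴·εreg` (resp. `≤ 10⁴·eR`), and that the heads' `R` arrives after `εreg`.  Nothing of Bałaban's asserted or
refuted; N12 NOT discharged; K0⁷ ∕ K1⁹ OPEN; counts unmoved (typed 28∕28 · discharged 8∕27); one finite 𝕋⁴ programme at fixed `ε = L^{-K}` — R4 closes only the conditional rung
`BalabanLadder.UV`; nothing continuum ∕ ℝ⁴ ∕ OS; the Yang–Mills mass gap (Clay) is NOT proved by any of this.
-/

noncomputable section

namespace Summit.QuantumFields.YangMills.BalabanUVNodes.N12DirectWindowRadiusFloor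

open scoped BigOperators

/-! ## §1  The arithmetic of the window (every symbol an abstract real) -/

/-- ★ **RADIUS FLOOR OF THE DIRECT WINDOW, ABSTRACT FORM.**  If a tolerance `δ` sits below the direct socket's explicit threshold (whose `S`-term carries the Cauchy quotient
`12𝓐₀ ∕ R · √Nb` squared) and above the window-local producer's floor `C₁·εreg + m′·ρn`, then `115200·(d−1)·𝓐₀²·Nb·(C₁·εreg) ≤ R²`.  Pure real arithmetic:
`rhs ≤ 1∕20` (`Kb ≥ 1`), `S ≥ 40(d−1)·Kc²`, `Kc² = 144𝓐₀²Nb∕R²`. [cite: Balaban1989LargeFieldI, (1.74) p.192, Prop. 1 p.194 (bookkeeping of the analyticity radius); Balaban1989LargeFieldII, (1.12)–(1.13) p.359] -/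
theorem radius_sq_floor_of_window_abstract {δ ρ ρτ εH dR KbR B₁ Sg M₂ Kτ bc C 𝓐₀ R Nb C₁ m' ρn εreg : ℝ}
    (hR : 0 < R) (hNb : 0 ≤ Nb) (hd : 1 ≤ dR) (hKb : 1 ≤ KbR) (hB1 : 0 ≤ B₁) (hSg : 0 ≤ Sg) (hM₂ : 0 ≤ M₂) (hKτ : 0 ≤ Kτ) (hbc : 0 ≤ bc)
    (hC₁ : 0 ≤ C₁) (hε : 0 ≤ εreg) (hm' : 0 ≤ m') (hρn : 0 ≤ ρn)
    (hδle : δ ≤ min (min (min ρ ρτ / 2)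
        (min 1 (1 / 2 / (2 * (3 * KbR ^ 2 + 2 * KbR ^ 4)) /
          (max ((32 * (dR - 1) + 8 * (dR - 1) + (2 * (dR - 1) * B₁ * (Sg * M₂))) * (12 * 𝓐₀ / R * Real.sqrt Nb) ^ 2
            + (8 * (dR + 1) * (2 * (Kτ + 1)) + 8 * dR * bc * (C * (12 * 𝓐₀ / R * Real.sqrt Nb)) ^ 2)) 0 + 1)))) εH)
    (hfloor : C₁ * εreg + m' * ρn ≤ δ) :
    115200 * (dR - 1) * 𝓐₀ ^ 2 * Nb * (C₁ * εreg) ≤ R ^ 2 := by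
  set Kc : ℝ := 12 * 𝓐₀ / R * Real.sqrt Nb with hKc
  have hKc2 : Kc ^ 2 = 144 * 𝓐₀ ^ 2 * Nb / R ^ 2 := by
    rw [hKc, mul_pow, div_pow, Real.sq_sqrt hNb]; ring
  set S : ℝ := (32 * (dR - 1) + 8 * (dR - 1) + (2 * (dR - 1) * B₁ * (Sg * M₂))) * Kc ^ 2
      + (8 * (dR + 1) * (2 * (Kτ + 1)) + 8 * dR * bc * (C * Kc) ^ 2) with hS
  have hd1 : 0 ≤ dR - 1 := by linarith
  have hd0 : 0 ≤ dR := by linarith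
  have hKc0 : 0 ≤ Kc ^ 2 := sq_nonneg _
  have hS₁ : 40 * (dR - 1) * Kc ^ 2 ≤ S := by
    have h1 : 0 ≤ 2 * (dR - 1) * B₁ * (Sg * M₂) * Kc ^ 2 := by positivity
    have h2 : 0 ≤ 8 * (dR + 1) * (2 * (Kτ + 1)) := by positivity
    have h3 : 0 ≤ 8 * dR * bc * (C * Kc) ^ 2 := by positivity
    have e : S = 40 * (dR - 1) * Kc ^ 2 + (2 * (dR - 1) * B₁ * (Sg * M₂) * Kc ^ 2
        + (8 * (dR + 1) * (2 * (Kτ + 1)) + 8 * dR * bc * (C * Kc) ^ 2)) := by rw [hS]; ring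
    rw [e]; linarith
  have hS₁0 : 0 ≤ 40 * (dR - 1) * Kc ^ 2 := by positivity
  have hrhs0 : (0 : ℝ) ≤ 1 / 2 / (2 * (3 * KbR ^ 2 + 2 * KbR ^ 4)) := by positivity
  have hrhs : 1 / 2 / (2 * (3 * KbR ^ 2 + 2 * KbR ^ 4)) ≤ 1 / 20 := by
    have hK2 : 1 ≤ KbR ^ 2 := by simpa using pow_le_pow_left₀ zero_le_one hKb 2
    have hK4 : 1 ≤ KbR ^ 4 := by simpa using pow_le_pow_left₀ zero_le_one hKb 4
    have h5 : (10 : ℝ) ≤ 2 * (3 * KbR ^ 2 + 2 * KbR ^ 4) := by linarith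
    rw [div_le_iff₀ (by positivity)]
    linarith
  -- δ ≤ rhs ∕ (max S 0 + 1) ≤ (1∕20) ∕ (40(d−1)Kc² + 1)
  have hδ1 : δ ≤ 1 / 2 / (2 * (3 * KbR ^ 2 + 2 * KbR ^ 4)) / (max S 0 + 1) :=
    (hδle.trans (min_le_left _ _)).trans ((min_le_right _ _).trans (min_le_right _ _))
  have hmax0 : 0 ≤ max S 0 := le_max_right _ _
  have hmax : 40 * (dR - 1) * Kc ^ 2 + 1 ≤ max S 0 + 1 := by linarith [le_max_left S 0]
  have hδ2 : δ ≤ (1 / 20) / (40 * (dR - 1) * Kc ^ 2 + 1) :=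
    calc δ ≤ 1 / 2 / (2 * (3 * KbR ^ 2 + 2 * KbR ^ 4)) / (max S 0 + 1) := hδ1
      _ ≤ (1 / 20) / (max S 0 + 1) := by gcongr
      _ ≤ (1 / 20) / (40 * (dR - 1) * Kc ^ 2 + 1) := by gcongr
  -- the floor: C₁·εreg ≤ δ
  have hfl : C₁ * εreg ≤ δ := by linarith [mul_nonneg hm' hρn]
  have hkey : C₁ * εreg * (40 * (dR - 1) * Kc ^ 2 + 1) ≤ 1 / 20 := by
    have := hfl.trans hδ2
    rwa [le_div_iff₀ (by positivity)] at this
  have hkey' : C₁ * εreg * (40 * (dR - 1) * Kc ^ 2) ≤ 1 / 20 := by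
    have h0 : 0 ≤ C₁ * εreg * 1 := by simpa using mul_nonneg hC₁ hε
    have : C₁ * εreg * (40 * (dR - 1) * Kc ^ 2) ≤ C₁ * εreg * (40 * (dR - 1) * Kc ^ 2 + 1) := by
      rw [mul_add]; linarith
    exact this.trans hkey
  rw [hKc2] at hkey'
  have hR2 : 0 < R ^ 2 := by positivity
  have e : C₁ * εreg * (40 * (dR - 1) * (144 * 𝓐₀ ^ 2 * Nb / R ^ 2))
      = (5760 * (dR - 1) * 𝓐₀ ^ 2 * Nb * (C₁ * εreg)) / R ^ 2 := by ring
  rw [e, div_le_iff₀ hR2] at hkey'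
  linarith


/-! ## §2  The floor at the direct socket's OWN rows (v12 T4 `…WindowDirectOfClassOnlyRowL1NearRadiusOfRecord` #10653, one instance `(P, i)`: every `x P i ↦ x`) -/

open Literature.MathematicalPhysics.QuantumFieldTheory.Balaban1983to89
open Literature.MathematicalPhysics.QuantumFieldTheory.Balaban1983to89.T4Continuum (T4Family)
open Literature.MathematicalPhysics.QuantumFieldTheory.Balaban1983to89.Node00
open T4AxialGaugeSmallField (castSite)
open B16Eq18Proof (box)
open B14.Eq213DetSet (maxDomT)

variable {F : T4Family}

/-- ★★ **THE DIRECT SOCKET's WINDOW DEMANDS A RADIUS FLOOR.**  At one instance `(P, i)` of the direct row socket of record (dag-n12-d g25 v12 T4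
`N12AtRecord13Prop1KnitThm1WindowDirectOfClassOnlyRowL1NearRadiusOfRecord.exists_areg_pinLF_b15Leaf_…_windowDirectOfClassOnlyRowL1NearRadius`, #10653 ✓p738673), its displayed
tolerance rows — the normaliser row `hρn`, the explicit threshold `δ P i ≤ min (…) (εH P i)` (whose `S`-term squares the Cauchy quotient `12·𝓐₀ P i ∕ R P i · √#{b ∕∕ b.src ∈ Ω₁(Z P i)}`
of the (J0′) letter `hMin`'s radius) and the window-local producer's floor `hfloor` (`C₁(d,L)·Θ.ν.εreg + m′·ρn P i ≤ δ P i`) — written VERBATIM with `x P i ↦ x` — force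
`115200·(d−1)·C₁(d,L)·(𝓐₀ P i)²·#{b ∕∕ b.src ∈ Ω₁(Z P i)}·Θ.ν.εreg ≤ (R P i)²`: the class threshold of record must lie BELOW a multiple of the SQUARE of the (J0′) analyticity
radius.  Hence a consumer of the socket needs the radius ANNOUNCED BEFORE (or bounded below independently of) `Θ.ν.εreg`; the (J0′) heads of record announce `∃ R` AFTER the class
threshold `εr` (`…KnitRowThm1NamedFactsOnZOfRecord` ✓p740879, `…KnitRowOfK0GridGNamedEUOnZOfRecord` ✓p742351, and every predecessor since `…KnitRowThm1Letters` v3: `∀ εr, … → ∃ R`).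
Typing-strength certificate (count-neutral); nothing of Bałaban's asserted. [cite: Balaban1989LargeFieldI, (1.74) p.192, Prop. 1 p.194; Balaban1989LargeFieldII, (1.12)–(1.13) p.359; Balaban1985Variational, Thm 1 (8) p.279] -/
theorem radius_sq_floor_of_directWindow (Θ : Stage13Params F 2) (P : B12.RunParams) (hd3 : 3 ≤ (F.P P.K).d)
    (Z : Set (Site (F.P P.K) 0)) (k : ℕ) (lo hi : Fin (F.P P.K).d → ℤ) {n n' Kb : ℕ} (hK1 : 1 ≤ Kb)
    {B₁ M₂ Kτ C ρ ρτ εH R 𝓐₀ ρn δ eR : ℝ} (hB1 : 0 ≤ B₁) (hM₂0 : 0 ≤ M₂) (hKτ : 0 ≤ Kτ) (hR : 0 < R) (heR : 0 < eR) (hεreg : 0 < Θ.ν.εreg)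
    -- T4's `hρn` row (the normaliser's bond tolerance below the datum tolerance `ρn`; it makes `ρn` non-negative)
    (hρn : (((F.P P.K).d : ℝ) * n' + 1) * ((((F.P P.K).d - 1 : ℕ) : ℝ) * n' * ((12 * (F.P P.K).d * (n + 2) ^ 2 + 1) * eR) + 3 * (F.P P.K).d * (n + 2) ^ 2 * eR) ≤ ρn)
    -- T4's explicit threshold row
    (hδle : δ ≤ min (min (min ρ ρτ / 2)
        (min 1 (1 / 2 / (2 * (3 * (Kb : ℝ) ^ 2 + 2 * (Kb : ℝ) ^ 4)) /
          (max ((32 * (((F.P P.K).d : ℝ) - 1) + 8 * (((F.P P.K).d : ℝ) - 1) + (2 * (((F.P P.K).d : ℝ) - 1) * B₁ * (((∑ j ∈ Finset.range (k + 1), (2 * (F.P P.K).d) ^ j : ℕ) : ℝ) * M₂))) * (12 * 𝓐₀ / R * Real.sqrt (Nat.card {b : PBond (F.P P.K) 0 // b.src ∈ maxDomT Θ.ν.M₁ Z 1})) ^ 2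
            + (8 * (((F.P P.K).d : ℝ) + 1) * (2 * (Kτ + 1)) + 8 * ((F.P P.K).d : ℝ) * (((box (fun κ => (hi κ - lo κ + 1).toNat + 3) (fun κ => lo κ - 2)).image (fun z => (castSite z : Site (F.P P.K) k))).card : ℝ) * (C * (12 * 𝓐₀ / R * Real.sqrt (Nat.card {b : PBond (F.P P.K) 0 // b.src ∈ maxDomT Θ.ν.M₁ Z 1}))) ^ 2)) 0 + 1)))) εH)
    -- T4's `hfloor` row (the k-free floor of the window-local producer)
    (hfloor : ((((4 * (F.P P.K).d + (3 * ((F.P P.K).d * (((F.P P.K).L - 1) / 2)) + 5) + 3 : ℕ) : ℝ)) ^ 2 * ((F.P P.K).L : ℝ) ^ 2 / 4 + ((3 * ((F.P P.K).d * (((F.P P.K).L - 1) / 2)) + 5 : ℕ) : ℝ) * (24 * (((((F.P P.K).d + 2) * (F.P P.K).L : ℕ) : ℝ) ^ 2 / 4))) * Θ.ν.εreg + ((3 * ((F.P P.K).d * (((F.P P.K).L - 1) / 2)) + 5 : ℕ) : ℝ) * ρn ≤ δ) :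
    115200 * (((F.P P.K).d : ℝ) - 1) * 𝓐₀ ^ 2 * (Nat.card {b : PBond (F.P P.K) 0 // b.src ∈ maxDomT Θ.ν.M₁ Z 1} : ℝ) *
      (((((4 * (F.P P.K).d + (3 * ((F.P P.K).d * (((F.P P.K).L - 1) / 2)) + 5) + 3 : ℕ) : ℝ)) ^ 2 * ((F.P P.K).L : ℝ) ^ 2 / 4 + ((3 * ((F.P P.K).d * (((F.P P.K).L - 1) / 2)) + 5 : ℕ) : ℝ) * (24 * (((((F.P P.K).d + 2) * (F.P P.K).L : ℕ) : ℝ) ^ 2 / 4))) * Θ.ν.εreg)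
      ≤ R ^ 2 := by
  have hd1 : (1 : ℝ) ≤ (F.P P.K).d := by exact_mod_cast le_trans (by norm_num) hd3
  have hρn0 : 0 ≤ ρn := le_trans (by positivity) hρn
  exact radius_sq_floor_of_window_abstract (ρ := ρ) (ρτ := ρτ) (εH := εH) (Kτ := Kτ) (C := C) (δ := δ)
    (Sg := (((∑ j ∈ Finset.range (k + 1), (2 * (F.P P.K).d) ^ j : ℕ) : ℝ)))
    (bc := ((((box (fun κ => (hi κ - lo κ + 1).toNat + 3) (fun κ => lo κ - 2)).image (fun z => (castSite z : Site (F.P P.K) k))).card : ℕ) : ℝ))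
    (Nb := (Nat.card {b : PBond (F.P P.K) 0 // b.src ∈ maxDomT Θ.ν.M₁ Z 1} : ℝ))
    hR (Nat.cast_nonneg _) hd1 (show (1 : ℝ) ≤ (Kb : ℝ) by exact_mod_cast hK1) hB1 (Nat.cast_nonneg _) hM₂0 hKτ (Nat.cast_nonneg _) (by positivity) hεreg.le
    (Nat.cast_nonneg _) hρn0 hδle hfloor

/-! ## §3  Numbers: `d = 4`, `L ≥ 12` ⇒ `R_i² ≥ 4·10⁹·(𝓐₀ P i)²·#bonds·εreg ≥ 4·10⁹·εreg`; and the contradiction with any radius `R_i ≤ 10⁴·εreg` -/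

/-- ★★ **THE FLOOR IN NUMBERS.**  With the family's `d = 4` (`T4Family.P_d`) and `L > 11` (`T4Family.hL11`), the floor coefficient `C₁(d,L) ≥ 19²·L²∕4 ≥ 12996`, so at any
non-degenerate instance (`Ω₁(Z)` has a bond) fed by a (J0′) witness with `𝓐₀ ≥ 1` (the family's real points are `SU(2)`-valued): `4·10⁹·Θ.ν.εreg ≤ (R P i)²`.
[cite: Balaban1989LargeFieldI, (1.74) p.192, Prop. 1 p.194; Balaban1989LargeFieldII, (1.12)–(1.13) p.359] -/
theorem radius_sq_floor_of_directWindow_numeric (Θ : Stage13Params F 2) (P : B12.RunParams) (hd3 : 3 ≤ (F.P P.K).d)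
    (Z : Set (Site (F.P P.K) 0)) (k : ℕ) (lo hi : Fin (F.P P.K).d → ℤ) {n n' Kb : ℕ} (hK1 : 1 ≤ Kb)
    {B₁ M₂ Kτ C ρ ρτ εH R 𝓐₀ ρn δ eR : ℝ} (hB1 : 0 ≤ B₁) (hM₂0 : 0 ≤ M₂) (hKτ : 0 ≤ Kτ) (hR : 0 < R) (heR : 0 < eR) (hεreg : 0 < Θ.ν.εreg)
    (h𝓐₀ : 1 ≤ 𝓐₀) (hNb : 1 ≤ Nat.card {b : PBond (F.P P.K) 0 // b.src ∈ maxDomT Θ.ν.M₁ Z 1})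
    (hρn : (((F.P P.K).d : ℝ) * n' + 1) * ((((F.P P.K).d - 1 : ℕ) : ℝ) * n' * ((12 * (F.P P.K).d * (n + 2) ^ 2 + 1) * eR) + 3 * (F.P P.K).d * (n + 2) ^ 2 * eR) ≤ ρn)
    (hδle : δ ≤ min (min (min ρ ρτ / 2)
        (min 1 (1 / 2 / (2 * (3 * (Kb : ℝ) ^ 2 + 2 * (Kb : ℝ) ^ 4)) /
          (max ((32 * (((F.P P.K).d : ℝ) - 1) + 8 * (((F.P P.K).d : ℝ) - 1) + (2 * (((F.P P.K).d : ℝ) - 1) * B₁ * (((∑ j ∈ Finset.range (k + 1), (2 * (F.P P.K).d) ^ j : ℕ) : ℝ) * M₂))) * (12 * 𝓐₀ / R * Real.sqrt (Nat.card {b : PBond (F.P P.K) 0 // b.src ∈ maxDomT Θ.ν.M₁ Z 1})) ^ 2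
            + (8 * (((F.P P.K).d : ℝ) + 1) * (2 * (Kτ + 1)) + 8 * ((F.P P.K).d : ℝ) * (((box (fun κ => (hi κ - lo κ + 1).toNat + 3) (fun κ => lo κ - 2)).image (fun z => (castSite z : Site (F.P P.K) k))).card : ℝ) * (C * (12 * 𝓐₀ / R * Real.sqrt (Nat.card {b : PBond (F.P P.K) 0 // b.src ∈ maxDomT Θ.ν.M₁ Z 1}))) ^ 2)) 0 + 1)))) εH)
    (hfloor : ((((4 * (F.P P.K).d + (3 * ((F.P P.K).d * (((F.P P.K).L - 1) / 2)) + 5) + 3 : ℕ) : ℝ)) ^ 2 * ((F.P P.K).L : ℝ) ^ 2 / 4 + ((3 * ((F.P P.K).d * (((F.P P.K).L - 1) / 2)) + 5 : ℕ) : ℝ) * (24 * (((((F.P P.K).d + 2) * (F.P P.K).L : ℕ) : ℝ) ^ 2 / 4))) * Θ.ν.εreg + ((3 * ((F.P P.K).d * (((F.P P.K).L - 1) / 2)) + 5 : ℕ) : ℝ) * ρn ≤ δ) :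
    4 * 10 ^ 9 * Θ.ν.εreg ≤ R ^ 2 := by
  have h := radius_sq_floor_of_directWindow Θ P hd3 Z k lo hi hK1 hB1 hM₂0 hKτ hR heR hεreg hρn hδle hfloor
  set C₁ : ℝ := ((((4 * (F.P P.K).d + (3 * ((F.P P.K).d * (((F.P P.K).L - 1) / 2)) + 5) + 3 : ℕ) : ℝ)) ^ 2 * ((F.P P.K).L : ℝ) ^ 2 / 4 + ((3 * ((F.P P.K).d * (((F.P P.K).L - 1) / 2)) + 5 : ℕ) : ℝ) * (24 * (((((F.P P.K).d + 2) * (F.P P.K).L : ℕ) : ℝ) ^ 2 / 4))) with hC₁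
  set Nb : ℝ := (Nat.card {b : PBond (F.P P.K) 0 // b.src ∈ maxDomT Θ.ν.M₁ Z 1} : ℝ) with hNbdef
  have hd : ((F.P P.K).d : ℝ) = 4 := by simp [T4Family.P_d]
  have hL : (12 : ℝ) ≤ (F.P P.K).L := by rw [T4Family.P_L]; exact_mod_cast F.hL11
  have h19 : (19 : ℝ) ≤ ((4 * (F.P P.K).d + (3 * ((F.P P.K).d * (((F.P P.K).L - 1) / 2)) + 5) + 3 : ℕ) : ℝ) := by
    have : 19 ≤ 4 * (F.P P.K).d + (3 * ((F.P P.K).d * (((F.P P.K).L - 1) / 2)) + 5) + 3 := by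
      simp only [T4Family.P_d]; omega
    exact_mod_cast this
  have hC₁ge : (12996 : ℝ) ≤ C₁ := by
    have h2 : 0 ≤ ((3 * ((F.P P.K).d * (((F.P P.K).L - 1) / 2)) + 5 : ℕ) : ℝ) * (24 * (((((F.P P.K).d + 2) * (F.P P.K).L : ℕ) : ℝ) ^ 2 / 4)) := by positivity
    have hsq : (361 : ℝ) ≤ ((4 * (F.P P.K).d + (3 * ((F.P P.K).d * (((F.P P.K).L - 1) / 2)) + 5) + 3 : ℕ) : ℝ) ^ 2 := by nlinarith
    have hL2 : (144 : ℝ) ≤ ((F.P P.K).L : ℝ) ^ 2 := by nlinarith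
    have hprod : (361 : ℝ) * 144 ≤ ((4 * (F.P P.K).d + (3 * ((F.P P.K).d * (((F.P P.K).L - 1) / 2)) + 5) + 3 : ℕ) : ℝ) ^ 2 * ((F.P P.K).L : ℝ) ^ 2 :=
      mul_le_mul hsq hL2 (by norm_num) (by positivity)
    rw [hC₁]; linarith
  have h1 : (1 : ℝ) ≤ 𝓐₀ ^ 2 := one_le_pow₀ h𝓐₀
  have h2 : (1 : ℝ) ≤ Nb := by rw [hNbdef]; exact_mod_cast hNb
  have hε := hεreg.le
  have hA : 12996 * Θ.ν.εreg ≤ C₁ * Θ.ν.εreg := mul_le_mul_of_nonneg_right hC₁ge hε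
  have hB : C₁ * Θ.ν.εreg ≤ Nb * (C₁ * Θ.ν.εreg) := le_mul_of_one_le_left (by positivity) h2
  have hC : Nb * (C₁ * Θ.ν.εreg) ≤ 𝓐₀ ^ 2 * (Nb * (C₁ * Θ.ν.εreg)) := le_mul_of_one_le_left (by positivity) h1
  rw [hd] at h
  have e : 115200 * ((4 : ℝ) - 1) * 𝓐₀ ^ 2 * Nb * (C₁ * Θ.ν.εreg) = 345600 * (𝓐₀ ^ 2 * (Nb * (C₁ * Θ.ν.εreg))) := by ring
  rw [e] at h
  linarith

/-- ★★★ **NO (J0′) WITNESS WITH `R_i ≤ 10⁴·εreg` FITS THE DIRECT SOCKET's WINDOW.**  Same rows plus T4's own `hα3` row (which makes `Θ.ν.εreg ≤ 1`): a radius at most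
`10⁴·Θ.ν.εreg` contradicts the floor `4·10⁹·Θ.ν.εreg ≤ R²`.  Relevance: a (J0′) producer that derives minimality at the real points of the `R`-ball from [15] Thm 1 over the class of
record keeps those points INSIDE the class `(6)@εreg`, i.e. within the regularity margin `εreg − B₃·ε_datum` of (8) — a radius of the order of `εreg`, never of `√εreg`
(see the module docstring; this second half is an argument about the producers' mechanism, NOT a kernel statement).  Typing-strength certificate; count-neutral; nothing of Bałaban's asserted.
[cite: Balaban1989LargeFieldI, (1.74) p.192, Prop. 1 p.194; Balaban1985Variational, Thm 1 (8) p.279, Prop. 4 (97)–(98) pp.292–293; Balaban1989LargeFieldII, (1.12)–(1.13) p.359] -/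
theorem false_of_directWindow_of_radius_le (Θ : Stage13Params F 2) (P : B12.RunParams) (hd3 : 3 ≤ (F.P P.K).d)
    (Z : Set (Site (F.P P.K) 0)) (k : ℕ) (lo hi : Fin (F.P P.K).d → ℤ) {n n' Kb : ℕ} (hK1 : 1 ≤ Kb)
    {B₁ M₂ Kτ C ρ ρτ εH R 𝓐₀ ρn δ eR : ℝ} (hB1 : 0 ≤ B₁) (hM₂0 : 0 ≤ M₂) (hKτ : 0 ≤ Kτ) (hR : 0 < R) (heR : 0 < eR) (hεreg : 0 < Θ.ν.εreg)
    (h𝓐₀ : 1 ≤ 𝓐₀) (hNb : 1 ≤ Nat.card {b : PBond (F.P P.K) 0 // b.src ∈ maxDomT Θ.ν.M₁ Z 1})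
    (hρn : (((F.P P.K).d : ℝ) * n' + 1) * ((((F.P P.K).d - 1 : ℕ) : ℝ) * n' * ((12 * (F.P P.K).d * (n + 2) ^ 2 + 1) * eR) + 3 * (F.P P.K).d * (n + 2) ^ 2 * eR) ≤ ρn)
    (hδle : δ ≤ min (min (min ρ ρτ / 2)
        (min 1 (1 / 2 / (2 * (3 * (Kb : ℝ) ^ 2 + 2 * (Kb : ℝ) ^ 4)) /
          (max ((32 * (((F.P P.K).d : ℝ) - 1) + 8 * (((F.P P.K).d : ℝ) - 1) + (2 * (((F.P P.K).d : ℝ) - 1) * B₁ * (((∑ j ∈ Finset.range (k + 1), (2 * (F.P P.K).d) ^ j : ℕ) : ℝ) * M₂))) * (12 * 𝓐₀ / R * Real.sqrt (Nat.card {b : PBond (F.P P.K) 0 // b.src ∈ maxDomT Θ.ν.M₁ Z 1})) ^ 2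
            + (8 * (((F.P P.K).d : ℝ) + 1) * (2 * (Kτ + 1)) + 8 * ((F.P P.K).d : ℝ) * (((box (fun κ => (hi κ - lo κ + 1).toNat + 3) (fun κ => lo κ - 2)).image (fun z => (castSite z : Site (F.P P.K) k))).card : ℝ) * (C * (12 * 𝓐₀ / R * Real.sqrt (Nat.card {b : PBond (F.P P.K) 0 // b.src ∈ maxDomT Θ.ν.M₁ Z 1}))) ^ 2)) 0 + 1)))) εH)
    (hfloor : ((((4 * (F.P P.K).d + (3 * ((F.P P.K).d * (((F.P P.K).L - 1) / 2)) + 5) + 3 : ℕ) : ℝ)) ^ 2 * ((F.P P.K).L : ℝ) ^ 2 / 4 + ((3 * ((F.P P.K).d * (((F.P P.K).L - 1) / 2)) + 5 : ℕ) : ℝ) * (24 * (((((F.P P.K).d + 2) * (F.P P.K).L : ℕ) : ℝ) ^ 2 / 4))) * Θ.ν.εreg + ((3 * ((F.P P.K).d * (((F.P P.K).L - 1) / 2)) + 5 : ℕ) : ℝ) * ρn ≤ δ)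
    -- T4's `hα3` row at the run `P` (the chart's near-flatness numerics on the class threshold)
    (hα3 : (143 * (((((F.P P.K).d + 4 : ℕ) : ℝ)) ^ 2 / 4) ^ 2) * (Θ.ν.εreg * (F.P P.K).L ^ 2) ≤ 1 / 3)
    -- the radius coupling of a Thm-1-born (J0′) producer (class-interior margin): NOT displayed by T4, the hypothesis under test
    (hRle : R ≤ 10 ^ 4 * Θ.ν.εreg) : False := by
  have h := radius_sq_floor_of_directWindow_numeric Θ P hd3 Z k lo hi hK1 hB1 hM₂0 hKτ hR heR hεreg h𝓐₀ hNb hρn hδle hfloor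
  have hL : (12 : ℝ) ≤ (F.P P.K).L := by rw [T4Family.P_L]; exact_mod_cast F.hL11
  have hd : ((((F.P P.K).d + 4 : ℕ) : ℝ)) = 8 := by simp [T4Family.P_d]
  rw [hd] at hα3
  have hL2 : (144 : ℝ) ≤ ((F.P P.K).L : ℝ) ^ 2 := by nlinarith
  have hε1 : Θ.ν.εreg ≤ 1 := by
    have : Θ.ν.εreg * 144 ≤ Θ.ν.εreg * ((F.P P.K).L : ℝ) ^ 2 := mul_le_mul_of_nonneg_left hL2 hεreg.le
    nlinarith
  have hR2 : R ^ 2 ≤ (10 ^ 4 * Θ.ν.εreg) ^ 2 := pow_le_pow_left₀ hR.le hRle 2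
  nlinarith


/-- ★★★ **THE SAME IN THE SMALL-FIELD BUDGET's CURRENCY.**  T4 also displays `heRa : (cE+1)·eR ≤ a₁′ ∧ B₃·((cE+1)·eR) ≤ Θ.ν.εreg` (the [15] comparability rows of the base
field's strict guard `eR`); with [15] (8)'s regularity constant normalised `1 ≤ B₃·(cE P + 1)` this gives `eR ≤ Θ.ν.εreg`, so a (J0′) radius confined to the guard budget,
`R ≤ 10⁴·eR` (the heads of record certify [15] Thm 1 for the perturbed data at smallness `ε := 2·(cE+1)·eR` only — base `eR` plus a perturbation budget `eR`), is refuted by the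
window as well.  Typing-strength certificate; count-neutral. [cite: Balaban1989LargeFieldI, (1.74) p.192, Prop. 1 p.194; Balaban1985Variational, (7) p.278, Thm 1 (8) p.279; Balaban1989LargeFieldII, (1.12)–(1.13) p.359] -/
theorem false_of_directWindow_of_radius_le_guard (Θ : Stage13Params F 2) (P : B12.RunParams) (hd3 : 3 ≤ (F.P P.K).d)
    (Z : Set (Site (F.P P.K) 0)) (k : ℕ) (lo hi : Fin (F.P P.K).d → ℤ) {n n' Kb : ℕ} (hK1 : 1 ≤ Kb)
    {B₁ M₂ Kτ C ρ ρτ εH R 𝓐₀ ρn δ eR : ℝ} (hB1 : 0 ≤ B₁) (hM₂0 : 0 ≤ M₂) (hKτ : 0 ≤ Kτ) (hR : 0 < R) (heR : 0 < eR) (hεreg : 0 < Θ.ν.εreg)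
    (h𝓐₀ : 1 ≤ 𝓐₀) (hNb : 1 ≤ Nat.card {b : PBond (F.P P.K) 0 // b.src ∈ maxDomT Θ.ν.M₁ Z 1})
    (hρn : (((F.P P.K).d : ℝ) * n' + 1) * ((((F.P P.K).d - 1 : ℕ) : ℝ) * n' * ((12 * (F.P P.K).d * (n + 2) ^ 2 + 1) * eR) + 3 * (F.P P.K).d * (n + 2) ^ 2 * eR) ≤ ρn)
    (hδle : δ ≤ min (min (min ρ ρτ / 2)
        (min 1 (1 / 2 / (2 * (3 * (Kb : ℝ) ^ 2 + 2 * (Kb : ℝ) ^ 4)) /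
          (max ((32 * (((F.P P.K).d : ℝ) - 1) + 8 * (((F.P P.K).d : ℝ) - 1) + (2 * (((F.P P.K).d : ℝ) - 1) * B₁ * (((∑ j ∈ Finset.range (k + 1), (2 * (F.P P.K).d) ^ j : ℕ) : ℝ) * M₂))) * (12 * 𝓐₀ / R * Real.sqrt (Nat.card {b : PBond (F.P P.K) 0 // b.src ∈ maxDomT Θ.ν.M₁ Z 1})) ^ 2
            + (8 * (((F.P P.K).d : ℝ) + 1) * (2 * (Kτ + 1)) + 8 * ((F.P P.K).d : ℝ) * (((box (fun κ => (hi κ - lo κ + 1).toNat + 3) (fun κ => lo κ - 2)).image (fun z => (castSite z : Site (F.P P.K) k))).card : ℝ) * (C * (12 * 𝓐₀ / R * Real.sqrt (Nat.card {b : PBond (F.P P.K) 0 // b.src ∈ maxDomT Θ.ν.M₁ Z 1}))) ^ 2)) 0 + 1)))) εH)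
    (hfloor : ((((4 * (F.P P.K).d + (3 * ((F.P P.K).d * (((F.P P.K).L - 1) / 2)) + 5) + 3 : ℕ) : ℝ)) ^ 2 * ((F.P P.K).L : ℝ) ^ 2 / 4 + ((3 * ((F.P P.K).d * (((F.P P.K).L - 1) / 2)) + 5 : ℕ) : ℝ) * (24 * (((((F.P P.K).d + 2) * (F.P P.K).L : ℕ) : ℝ) ^ 2 / 4))) * Θ.ν.εreg + ((3 * ((F.P P.K).d * (((F.P P.K).L - 1) / 2)) + 5 : ℕ) : ℝ) * ρn ≤ δ)
    (hα3 : (143 * (((((F.P P.K).d + 4 : ℕ) : ℝ)) ^ 2 / 4) ^ 2) * (Θ.ν.εreg * (F.P P.K).L ^ 2) ≤ 1 / 3)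
    -- T4's `heRa` row at (P, i): the [15] comparability rows of the strict guard
    {cE a₁' B₃ : ℝ} (heRa : (cE + 1) * eR ≤ a₁' ∧ B₃ * ((cE + 1) * eR) ≤ Θ.ν.εreg)
    -- [15] (8)'s constant normalised (the minimiser's plaquettes are not smaller than the datum's budget): NOT displayed by T4
    (hB₃ : 1 ≤ B₃ * (cE + 1))
    -- the radius confined to the guard budget: NOT displayed by T4, the hypothesis under test
    (hRle : R ≤ 10 ^ 4 * eR) : False := by
  have heRε : eR ≤ Θ.ν.εreg := by
    have : eR ≤ B₃ * (cE + 1) * eR := le_mul_of_one_le_left heR.le hB₃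
    linarith [heRa.2]
  exact false_of_directWindow_of_radius_le Θ P hd3 Z k lo hi hK1 hB1 hM₂0 hKτ hR heR hεreg h𝓐₀ hNb hρn hδle hfloor hα3
    (hRle.trans (by linarith))

end Summit.QuantumFields.YangMills.BalabanUVNodes.N12DirectWindowRadiusFloor

end
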